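import Summits.BirchSwinnertonDyer.BirchSwinnertonDyer.Theorems.SchneiderFreeAdditiveX3PoitouTateShaDualityHolds
import Summits.BirchSwinnertonDyer.BirchSwinnertonDyer.Theorems.SchneiderFreeAdditiveX3AnticycControlAdditiveKStubBaseCountTors
import HarnessLib

/-!
# Crux `AnticycControlAdditiveK` (route `SchneiderFreeAdditiveX3`, item stmt-BirchSwinnertonDyer-19295) — PROVED

Cell `bsd-schneider-ideate`, seat `bsd-schneider-door-c4` (prover, generation 19).  PARTITION: board row B6 ∩ X3 ∩ sst-twist,
`r = 1`, of `Rank1Residual.partition` — CONTROL corner; this file CLOSES the crux leaf of rung K1-door («closes rung K1-door leaf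
19295 of BirchSwinnertonDyer» — a LEAF, never the summit).  bears_on: K1-door (r1, B6∩X3-sst)
(route-BirchSwinnertonDyer-SchneiderFreeAdditiveX3 items 18969 → 19295).

THE STATEMENT (`Theses.SchneiderFreeAdditiveX3.AnticycControlAdditiveK`, by name): UNDER Kolyvagin's theorem as the displayed
printed-fact antecedent `(∀ N W K, kolyvagin N W K) →`, for every globally minimal `E/ℚ` with `r_an = 1`, odd `p`, `E` in B6's
reducible semistable-twist class (`ClassX3`, `SubSemistableTwist`): the pointwise anticyclotomic control input
`SchneiderFree.AdditiveControlInputManinAt E p` (the JSW17-type control equality at an additive prime split in the Heegner field,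
Euler shift `0`, `t_p` cancelling).

THE PROOF = the cell's assembly, every input now a tree theorem: door-c4 g18's `anticycControlAdditiveK_of_sha_tateDual`
(skeleton v3-K stubs `stub_kerRes`/`stub_kerLoc` (door-c5), `stub_localKernelOrder`, `stub_baseCountTors` (door-c4 g18 on PT (i)
`poitouTate_selmerStructure_duality_holds`), `stub_ptSurj_of_kolyvagin` / `stub_coinv_of_poitouTate_sha` (door-c6), Brink's atoms,
door-c4's glue `additiveControlOnTreeAt_of_torsAtoms`) fed with PT (ii) for every number field, `poitouTate_sha_tateDual_holds`
(door-c4 g19 / door-c5 g18 / door-c6 / bsd-line-chl-p2 / bsd-inputs-k4-p1, 2026-08-26…28).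

HONEST FRAMING: the theorem is CONDITIONAL exactly as filed — Kolyvagin's theorem (`Literature.NumberTheory.EllipticCurves.kolyvagin`,
Gross 1991 Thm. 1.3, cite-only) is its displayed antecedent and is NOT proved here; no other named fact enters (std axioms).  BSD is
NOT proved by this: it closes one rung-K1-door leaf of `BirchSwinnertonDyer`, a pointwise control input on one board cell.
References: [JetchevSkinnerWan2017] Thm. 3.3.1, Prop. 3.2.1, Prop. 3.3.4 (arXiv:1512.06894 §3); [MilneADT2006] I Thm. 4.10 (a),(b);
[Brink2007] Thm. 2, Cor. 1; [Gross1991] Thm. 1.3.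
-/

noncomputable section

-- `Summit.<P>.<Sub>` repeats `BirchSwinnertonDyer` by the tree's layout convention (D-0017)
set_option linter.dupNamespace false

namespace Summit.BirchSwinnertonDyer.BirchSwinnertonDyer.Theorems.SchneiderFreeAdditiveX3

open Summit.BirchSwinnertonDyer.BirchSwinnertonDyer.Theorems.SchneiderFreeAdditiveX3.PoitouTateReduction
  (poitouTate_sha_tateDual_holds)

/-- **The crux `AnticycControlAdditiveK` (item stmt-BirchSwinnertonDyer-19295), proved** — under its displayed Kolyvagin
antecedent, anticyclotomic control at an additive prime split in the Heegner field on B6 ∩ X3 ∩ sst-twist, `r_an = 1`, `p` odd: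
door-c4 g18's `anticycControlAdditiveK_of_sha_tateDual` with Poitou–Tate (ii) supplied by `poitouTate_sha_tateDual_holds`.
Closes a LEAF of rung K1-door; BSD is not proved by this.
[cite: JetchevSkinnerWan2017, Thm. 3.3.1 (arXiv:1512.06894 p. 11)][cite: MilneADT2006, Ch. I, Thm. 4.10 (a),(b)]
[cite: Brink2007, Thm. 2 and Cor. 1][cite: Gross1991, Thm. 1.3] -/
theorem anticycControlAdditiveK_proof :
    Summit.BirchSwinnertonDyer.BirchSwinnertonDyer.Theses.SchneiderFreeAdditiveX3.AnticycControlAdditiveK :=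
  anticycControlAdditiveK_of_sha_tateDual fun K _ _ => poitouTate_sha_tateDual_holds K

end Summit.BirchSwinnertonDyer.BirchSwinnertonDyer.Theorems.SchneiderFreeAdditiveX3

end
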